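import Mathlib.MeasureTheory.Measure.Prod
import Mathlib.MeasureTheory.Measure.Real
import Mathlib.MeasureTheory.Integral.Bochner.Basic
import Mathlib.MeasureTheory.Integral.Bochner.Set
import HarnessLib

/-!
# Transferring an expectation along a coupling

Topic `Literature/Probability/Distributions` (general measure theory; everything is proved). The
elementary inequality by which an expectation is transported along a coupling that makes two
random elements close with high probability (Lindvall, *Lectures on the Coupling Method* (1992),
§I.2 "the coupling inequality"; Villani, *Optimal Transport* (2009), Ch. 6): if `P` is a measure
on `Ω × Ω'` with marginals `μ`, `μ'` and `g`, `g'` are integrable, then for every event `G`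
("the coupling is good")

  `|∫ g dμ − ∫ g' dμ'| ≤ ∫_G |g ∘ fst − g' ∘ snd| dP + ∫_{Gᶜ} |g ∘ fst| dP + ∫_{Gᶜ} |g' ∘ snd| dP`

(`abs_integral_sub_integral_le_of_coupling`). On `G` one uses the closeness of the coupled
elements and a modulus of continuity of the functional; off `G` one needs uniform integrability
(for bounded functionals, `P(Gᶜ) ·` the bound: `abs_integral_sub_integral_le_of_coupling_of_bound`).
This is the first step of every "couple and transfer" argument for loop functionals along
DKKMO's coupling distance `d_CN` (Duminil-Copin–Kozlowski–Krachun–Manolescu–Oulamara,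
arXiv:2012.11672v2, eq. (2); e.g. the transfer of the truncated nesting transform in
`TransferContinuity` of route `CardyMagicRigidity`).

## References

* T. Lindvall, *Lectures on the Coupling Method*, Wiley (1992), §I.2.
* C. Villani, *Optimal Transport, Old and New*, Springer (2009), Ch. 6 (couplings and distances).
-/

noncomputable section

open MeasureTheory Set Function Filter
open scoped ENNReal Topology

namespace Literature.Probability.Distributions

variable {Ω Ω' : Type*} [MeasurableSpace Ω] [MeasurableSpace Ω']

/-- **The coupling transfer inequality.** For a measure `P` on `Ω × Ω'` with marginals
`P ∘ fst⁻¹ = μ`, `P ∘ snd⁻¹ = μ'`, integrable `g : Ω → ℝ`, `g' : Ω' → ℝ` (a.e.-strongly measurable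
suffices for the pull-backs) and any event `G ⊆ Ω × Ω'`:
`|∫ g dμ − ∫ g' dμ'| ≤ ∫_G |g(ω) − g'(ω')| dP + ∫_{Gᶜ} |g(ω)| dP + ∫_{Gᶜ} |g'(ω')| dP`.
[folklore] -/
theorem abs_integral_sub_integral_le_of_coupling {P : Measure (Ω × Ω')} {μ : Measure Ω}
    {μ' : Measure Ω'} (h₁ : P.map Prod.fst = μ) (h₂ : P.map Prod.snd = μ') {g : Ω → ℝ}
    {g' : Ω' → ℝ} (hg : Integrable g μ) (hg' : Integrable g' μ') {G : Set (Ω × Ω')}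
    (hG : MeasurableSet G) :
    |(∫ ω, g ω ∂μ) - ∫ ω', g' ω' ∂μ'| ≤
      (∫ p in G, |g p.1 - g' p.2| ∂P) + (∫ p in Gᶜ, |g p.1| ∂P) + ∫ p in Gᶜ, |g' p.2| ∂P := by
  subst h₁ h₂
  -- pull both integrals back to the coupling
  have hG1 : Integrable (fun p : Ω × Ω' ↦ g p.1) P :=
    (integrable_map_measure hg.aestronglyMeasurable measurable_fst.aemeasurable).1 hg
  have hG2 : Integrable (fun p : Ω × Ω' ↦ g' p.2) P :=
    (integrable_map_measure hg'.aestronglyMeasurable measurable_snd.aemeasurable).1 hg'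
  have hsub : Integrable (fun p : Ω × Ω' ↦ g p.1 - g' p.2) P := hG1.sub hG2
  rw [integral_map measurable_fst.aemeasurable hg.aestronglyMeasurable,
    integral_map measurable_snd.aemeasurable hg'.aestronglyMeasurable, ← integral_sub hG1 hG2,
    ← integral_add_compl hG hsub]
  have hA : |∫ p in G, g p.1 - g' p.2 ∂P| ≤ ∫ p in G, |g p.1 - g' p.2| ∂P :=
    abs_integral_le_integral_abs
  have hB : |∫ p in Gᶜ, g p.1 - g' p.2 ∂P| ≤ (∫ p in Gᶜ, |g p.1| ∂P) + ∫ p in Gᶜ, |g' p.2| ∂P := by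
    calc |∫ p in Gᶜ, g p.1 - g' p.2 ∂P| ≤ ∫ p in Gᶜ, |g p.1 - g' p.2| ∂P := abs_integral_le_integral_abs
      _ ≤ ∫ p in Gᶜ, |g p.1| + |g' p.2| ∂P := by
          refine integral_mono_of_nonneg (Eventually.of_forall fun p ↦ abs_nonneg _)
            ((hG1.abs.add hG2.abs).integrableOn) (Eventually.of_forall fun p ↦ abs_sub _ _)
      _ = (∫ p in Gᶜ, |g p.1| ∂P) + ∫ p in Gᶜ, |g' p.2| ∂P :=
          integral_add hG1.abs.integrableOn hG2.abs.integrableOn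
  calc |(∫ p in G, g p.1 - g' p.2 ∂P) + ∫ p in Gᶜ, g p.1 - g' p.2 ∂P|
      ≤ |∫ p in G, g p.1 - g' p.2 ∂P| + |∫ p in Gᶜ, g p.1 - g' p.2 ∂P| := abs_add_le _ _
    _ ≤ _ := by linarith

/-- **Bounded functionals**: if moreover `|g| ≤ M` and `|g'| ≤ M'` everywhere, the bad event costs
at most `(M + M') · P(Gᶜ)`:
`|∫ g dμ − ∫ g' dμ'| ≤ ∫_G |g(ω) − g'(ω')| dP + (M + M') · P(Gᶜ)`. [folklore] -/
theorem abs_integral_sub_integral_le_of_coupling_of_bound {P : Measure (Ω × Ω')}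
    [IsFiniteMeasure P] {μ : Measure Ω} {μ' : Measure Ω'} (h₁ : P.map Prod.fst = μ)
    (h₂ : P.map Prod.snd = μ') {g : Ω → ℝ} {g' : Ω' → ℝ} (hg : Integrable g μ)
    (hg' : Integrable g' μ') {M M' : ℝ} (hM : ∀ ω, |g ω| ≤ M) (hM' : ∀ ω', |g' ω'| ≤ M')
    {G : Set (Ω × Ω')} (hG : MeasurableSet G) :
    |(∫ ω, g ω ∂μ) - ∫ ω', g' ω' ∂μ'| ≤ (∫ p in G, |g p.1 - g' p.2| ∂P) + (M + M') * P.real Gᶜ := by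
  refine (abs_integral_sub_integral_le_of_coupling h₁ h₂ hg hg' hG).trans ?_
  have h1 : ∫ p in Gᶜ, |g p.1| ∂P ≤ M * P.real Gᶜ := by
    calc ∫ p in Gᶜ, |g p.1| ∂P ≤ ∫ _p in Gᶜ, M ∂P := by
          refine setIntegral_mono_on ?_ (integrableOn_const (measure_ne_top _ _)) hG.compl
            fun p _ ↦ hM p.1
          subst h₁
          exact ((integrable_map_measure hg.aestronglyMeasurable
            measurable_fst.aemeasurable).1 hg).abs.integrableOn
      _ = M * P.real Gᶜ := by rw [setIntegral_const, smul_eq_mul, mul_comm]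
  have h2 : ∫ p in Gᶜ, |g' p.2| ∂P ≤ M' * P.real Gᶜ := by
    calc ∫ p in Gᶜ, |g' p.2| ∂P ≤ ∫ _p in Gᶜ, M' ∂P := by
          refine setIntegral_mono_on ?_ (integrableOn_const (measure_ne_top _ _)) hG.compl
            fun p _ ↦ hM' p.2
          subst h₂
          exact ((integrable_map_measure hg'.aestronglyMeasurable
            measurable_snd.aemeasurable).1 hg').abs.integrableOn
      _ = M' * P.real Gᶜ := by rw [setIntegral_const, smul_eq_mul, mul_comm]
  linarith

end Literature.Probability.Distributions

end
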